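import Mathlib.AlgebraicGeometry.Fiber
import Mathlib.AlgebraicGeometry.Morphisms.Smooth
import Mathlib.AlgebraicGeometry.Noetherian
import HarnessLib

/-!
# Smooth closed points on every component of a fibre (de Jong 1996, 4.11 (ii) b))

Topic: `Literature/AlgebraicGeometry/Resolution`. Property (ii) b) of de Jong 1996, Lemma 4.11 —
"The smooth locus of `f` is dense in all fibres of `f`" — is used in 4.12 ("`Y' → ℙ^{d-1}` is
(finite) étale, in view of property (ii) b)") through the following consequence, PROVED here
(`exists_smooth_closed_points_on_fiber`): for `f : X → Y` quasi-compact and locally of finite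
presentation with `Y` locally Noetherian, and a closed point `y` such that the smooth locus of
`f` is dense in the fibre `X_y`, there are FINITELY many closed points `xᵢ` of `X` over `y`, in
the smooth locus of `f`, such that every non-empty open-and-closed subset of the fibre `X_y`
contains one of them. (One closed point of the Jacobson, Noetherian scheme `X_y` in the smooth
locus inside the open part `(⋃_{Z' ≠ Z} Z')ᶜ ⊆ Z` of each irreducible component `Z`; a
non-empty clopen subset contains the irreducible component of any of its points.)
[folklore]; no definitions, no named facts.

## Sources

* A. J. de Jong, *Smoothness, semi-stability and alterations*, Publ. Math. IHÉS 83 (1996),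
  Lemma 4.11 (ii) b) and 4.12, pp. 67–68. [DeJong1996]
-/

noncomputable section

open CategoryTheory CategoryTheory.Limits AlgebraicGeometry TopologicalSpace

namespace Literature.AlgebraicGeometry.Resolution

universe u

/-- In a space with finitely many irreducible components, each irreducible component `Z`
contains a non-empty open subset of the space, namely the complement of the other components.
[folklore] -/
theorem exists_isOpen_nonempty_subset_of_mem_irreducibleComponents {α : Type*}
    [TopologicalSpace α] (hfin : (irreducibleComponents α).Finite) {Z : Set α}
    (hZ : Z ∈ irreducibleComponents α) :
    ∃ O : Set α, IsOpen O ∧ O.Nonempty ∧ O ⊆ Z := by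
  refine ⟨(⋃₀ (irreducibleComponents α \ {Z}))ᶜ, ?_, ?_, ?_⟩
  · rw [Set.sUnion_eq_biUnion, isOpen_compl_iff]
    exact hfin.sdiff.isClosed_biUnion fun W hW ↦ isClosed_of_mem_irreducibleComponents W hW.1
  · rw [Set.nonempty_compl]
    intro h
    have hsub : Z ⊆ ⋃₀ (irreducibleComponents α \ {Z}) := h ▸ Set.subset_univ Z
    exact (mem_of_subset_sUnion_irreducibleComponents Z hZ _ hfin.sdiff Set.sdiff_subset hsub).2
      (Set.mem_singleton Z)
  · intro a ha
    have h := subset_closure ha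
    rwa [closure_sUnion_irreducibleComponents_sdiff_singleton hfin Z hZ] at h

/-- **Smooth closed points on every component of a fibre**: let `f : X → Y` be quasi-compact
and locally of finite presentation, `Y` locally Noetherian, `y ∈ Y` a closed point such that
the smooth locus of `f` is dense in the fibre `X_y` (de Jong 1996, 4.11 (ii) b)). Then there are
finitely many closed points `xᵢ ∈ X` over `y` in the smooth locus of `f` such that every
non-empty clopen subset of the fibre `X_y` contains one of them.
[cite: DeJong1996, Lemma 4.11 (ii) b), p. 67] -/
theorem exists_smooth_closed_points_on_fiber {X Y : Scheme.{u}} (f : X ⟶ Y) [QuasiCompact f]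
    [LocallyOfFinitePresentation f] [IsLocallyNoetherian Y] (y : Y)
    (hy : IsClosed ({y} : Set Y))
    (hsm : Dense ((f.fiberι y) ⁻¹' (f.smoothLocus : Set X))) :
    ∃ (ι : Type u) (_ : Finite ι) (x : ι → X),
      (∀ i, x i ∈ f.smoothLocus) ∧ (∀ i, IsClosed ({x i} : Set X)) ∧ (∀ i, f (x i) = y) ∧
      ∀ W : Set ↥(f.fiber y), IsClopen W → W.Nonempty →
        ∃ i, ∃ z : ↥(f.fiber y), z ∈ W ∧ f.fiberι y z = x i := by
  -- the fibre is a Noetherian, Jacobson scheme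
  let F := f.fiber y
  haveI : IsLocallyNoetherian (Spec (Y.residueField y)) := inferInstance
  haveI : LocallyOfFiniteType (f.fiberToSpecResidueField y) :=
    MorphismProperty.pullback_snd (P := @LocallyOfFiniteType) _ _ inferInstance
  haveI : IsLocallyNoetherian F :=
    LocallyOfFiniteType.isLocallyNoetherian (f.fiberToSpecResidueField y)
  haveI : IsNoetherian F := ⟨⟩
  have hfin : (irreducibleComponents F).Finite := NoetherianSpace.finite_irreducibleComponents
  haveI : Finite (irreducibleComponents F) := hfin.to_subtype
  -- one smooth closed point in the open part of each irreducible component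
  have hpt : ∀ Z : irreducibleComponents F, ∃ z : F, z ∈ (Z : Set F) ∧ IsClosed ({z} : Set F) ∧
      z ∈ (f.fiberι y) ⁻¹' (f.smoothLocus : Set X) := by
    intro Z
    obtain ⟨O, hO, hOne, hOZ⟩ := exists_isOpen_nonempty_subset_of_mem_irreducibleComponents hfin Z.2
    have hO' : IsOpen (O ∩ (f.fiberι y) ⁻¹' (f.smoothLocus : Set X)) :=
      hO.inter (f.smoothLocus.isOpen.preimage (f.fiberι y).continuous)
    have hne : (O ∩ (f.fiberι y) ⁻¹' (f.smoothLocus : Set X)).Nonempty :=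
      hsm.inter_open_nonempty O hO hOne
    obtain ⟨z, ⟨hzO, hzs⟩, hzc⟩ := nonempty_inter_closedPoints hne hO'.isLocallyClosed
    exact ⟨z, hOZ hzO, hzc, hzs⟩
  choose z hzZ hzc hzs using hpt
  -- the embedding of the fibre is closed (its range is `f⁻¹{y}`, `y` closed)
  have hemb : Topology.IsClosedEmbedding (f.fiberι y) :=
    ⟨(f.fiberι y).isEmbedding, by
      rw [Scheme.Hom.range_fiberι]
      exact hy.preimage f.continuous⟩
  refine ⟨irreducibleComponents F, inferInstance, fun Z => f.fiberι y (z Z), fun Z => hzs Z,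
    fun Z => ?_, fun Z => ?_, fun W hW hWne => ?_⟩
  · rw [← Set.image_singleton]
    exact hemb.isClosedMap _ (hzc Z)
  · have : f.fiberι y (z Z) ∈ Set.range (f.fiberι y) := ⟨_, rfl⟩
    rw [Scheme.Hom.range_fiberι] at this
    exact this
  · obtain ⟨w, hw⟩ := hWne
    let Z : irreducibleComponents F := ⟨irreducibleComponent w,
      irreducibleComponent_mem_irreducibleComponents w⟩
    have hZW : (Z : Set F) ⊆ W :=
      (isIrreducible_irreducibleComponent).2.isPreconnected.subset_isClopen hW
        ⟨w, mem_irreducibleComponent, hw⟩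
    exact ⟨Z, z Z, hZW (hzZ Z), rfl⟩

end Literature.AlgebraicGeometry.Resolution

end
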